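import Literature.Analysis.FluidPDE.ElgindiPolarEnergyTwoSingular
import HarnessLib

/-!
# The lower-order ("`E`") terms of Step 2 of Elgindi's weighted elliptic estimate
([Elgindi2021] §7.3, Proposition 7.7, Step 2)

Topic `Literature/Analysis/FluidPDE`. Proof file (everything proved, no definitions, no named
facts) on the proof path of the named fact
`Literature.Analysis.FluidPDE.Elgindi.ElgindiGhoulMasmoudi2021_stabilityCore`
(`ElgindiStabilityDecomposition.lean`). T. M. Elgindi, Ann. of Math. 194 (2021) =
arXiv:1904.04795, §7.3, proof of Proposition 7.7, Step 2 (p. 21 of the held text):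

> "For `I₅`, that `|Ψ w/sin(2θ)^{η/2}|_{L²} ≤ |∂_θΨ w|_{L²} ≤ |Fw|_{L²}` using the Hardy inequality and
> (7.2) from Step 1. Similarly, for `I₂`, observe that `α|R∂_RΨ w/sin(2θ)^{η/2}|_{L²} ≤
> Cα|R∂_{Rθ}Ψ w|_{L²} ≤ C|Fw|_{L²}` again using the Hardy inequality and (7.2). […] we will denote
> by `E` an error which […] can be controlled in a similar way to how `I₅` and `I₂` were just
> estimated. […] Now, by the sharp Hardy inequality (7.6), we have […]"

These are the plane (`dR dθ` over the strip) versions of the one-dimensional angular inequalities,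
obtained slice by slice (`integral_strip_mono_of_slices`): for the a-priori class `Ψ = cos θ·χ`
(`χ ∈ C³(ℝ²)` compactly supported inside `R > 0`, `χ(R,0) = 0`), a radial weight `W ≥ 0`
continuous on `(0,∞)`, and `u = sin(2θ)^{−η}`, `0 ≤ η < 1`:

* `integral_strip_sq_rpow_le_ten_dθ`: `∫∫ W u Ψ² ≤ 10∫∫ W (∂_θΨ)²` and
  `integral_strip_dz_sq_rpow_le_ten`: `∫∫ R²W u (∂_RΨ)² ≤ 10∫∫ R²W (∂_{Rθ}Ψ)²` (Lemma 7.2);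
* `integral_strip_chi_sq_rpow_le`, `integral_strip_dθ_sq_rpow_le`: the `sec(θ)Ψ`-terms,
  `∫∫ W u g² ≤ (4/(1−η))∫∫ W g² + (π²/(2(1−η)))∫∫ W (∂_θg)²` for `g = χ, ∂_θΨ` (no Dirichlet data);
* `integral_strip_sharpHardy_dz`, `integral_strip_sharpHardy`: the SHARP terms,
  `(1+η)²∫∫ R²W c² u (∂_RΨ/s)² ≤ ∫∫ R²W u (∂_{Rθ}Ψ)²` and `(1+η)²∫∫ W c² u (Ψ/s)² ≤ ∫∫ W u (∂_θΨ)²`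
  (Corollary 7.6, `c = cos 2θ`, `s = sin 2θ`);
* `integral_strip_le_rpow`: `∫∫ W G² ≤ ∫∫ W u G²` (`u ≥ 1`).
-/

noncomputable section

open MeasureTheory Set Real Filter Function intervalIntegral
open _root_.Topology

namespace Literature.Analysis.FluidPDE

namespace Elgindi

/-! ### Slice-wise comparison of strip integrals -/

/-- If two functions are integrable on the strip and the angular slice integrals compare for every
`R > 0`, the strip integrals compare. [folklore] -/
theorem integral_strip_mono_of_slices {Φ₁ Φ₂ : ℝ × ℝ → ℝ} (h1 : IntegrableOn Φ₁ strip) (h2 : IntegrableOn Φ₂ strip)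
    (h : ∀ R, 0 < R → ∫ θ in Ioo 0 (π / 2), Φ₁ (R, θ) ≤ ∫ θ in Ioo 0 (π / 2), Φ₂ (R, θ)) :
    ∫ p in strip, Φ₁ p ≤ ∫ p in strip, Φ₂ p := by
  have hd : IntegrableOn (fun p => Φ₂ p - Φ₁ p) strip := h2.sub h1
  have hprod : ∀ {Φ : ℝ × ℝ → ℝ}, IntegrableOn Φ strip →
      ∀ᵐ R ∂(volume.restrict (Ioi (0 : ℝ))), IntegrableOn (fun θ => Φ (R, θ)) (Ioo 0 (π / 2)) := by
    intro Φ hΦ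
    have hΦ' : Integrable Φ ((volume.restrict (Ioi (0 : ℝ))).prod (volume.restrict (Ioo 0 (π / 2)))) := by
      rw [Measure.prod_restrict, ← Measure.volume_eq_prod]; exact hΦ
    exact hΦ'.prod_right_ae
  rw [← sub_nonneg, ← integral_sub h2 h1, integral_strip_eq_integral_Ioi_integral_Ioo' hd]
  refine setIntegral_nonneg_of_ae_restrict ?_
  filter_upwards [hprod h1, hprod h2, ae_restrict_mem measurableSet_Ioi] with R i1 i2 hR
  simp only [Pi.zero_apply]
  rw [integral_sub i2 i1]
  linarith [h R hR]

/-! ### The profile class: common facts -/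

section profile

variable {η : ℝ} (hη0 : 0 ≤ η) (hη1 : η < 1) {W : ℝ → ℝ} (hWc : ContinuousOn W (Ioi 0))
  (hW0 : ∀ R, 0 < R → 0 ≤ W R) {χ : ℝ → ℝ → ℝ} (hχ : ContDiff ℝ 3 (uncurry χ))
  (hs : HasCompactSupport (uncurry χ)) (hpos : ∀ p ∈ tsupport (uncurry χ), 0 < p.1)
  (hχ0 : ∀ R, χ R 0 = 0) {Ψ : ℝ → ℝ → ℝ} (hΨ : Ψ = fun R θ => Real.cos θ * χ R θ)

include hη0 hη1 hWc hW0 hχ hs hpos hχ0 hΨ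

/-- **`∫∫ W u Ψ² ≤ 10∫∫ W (∂_θΨ)²`** (`u = sin(2θ)^{−η}`; Lemma 7.2 slice-wise). [cite: Elgindi2021, §7.3 proof of Proposition 7.7 Step 2, estimate of `I₅` (p. 21 of arXiv:1904.04795)] -/
theorem integral_strip_sq_rpow_le_ten_dθ :
    ∫ p in strip, W p.1 * Ψ p.1 p.2 ^ 2 * Real.sin (2 * p.2) ^ (-η) ≤
      10 * ∫ p in strip, W p.1 * dθ Ψ p.1 p.2 ^ 2 := by
  have hχ1 : ContDiff ℝ 1 (uncurry χ) := hχ.of_le (by norm_num)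
  have hΨ3 : ContDiff ℝ 3 (uncurry Ψ) := by rw [hΨ]; exact contDiff_cosProfile hχ
  have hΨ1 : ContDiff ℝ 1 (uncurry Ψ) := hΨ3.of_le (by norm_num)
  have hΨs : HasCompactSupport (uncurry Ψ) := by rw [hΨ]; exact hasCompactSupport_cosProfile hs
  have hdθΨ : ContDiff ℝ 2 (uncurry (dθ Ψ)) := contDiff_dθ_of_contDiff (n := 2) hΨ3
  have hdθΨs : HasCompactSupport (uncurry (dθ Ψ)) := hasCompactSupport_dθ_of hΨs
  have cΨ : Continuous fun p : ℝ × ℝ => Ψ p.1 p.2 := hΨ3.continuous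
  have cdθ : Continuous fun p : ℝ × ℝ => dθ Ψ p.1 p.2 := hdθΨ.continuous
  obtain ⟨a, ha, hva⟩ := exists_pos_forall_fst_lt_eq_zero hs hpos
  have hvaχ : ∀ p : ℝ × ℝ, p.1 < a → χ p.1 p.2 = 0 := fun p hp => hva p hp
  have hvaΨ : ∀ p : ℝ × ℝ, p.1 < a → Ψ p.1 p.2 = 0 := fun p hp => by rw [hΨ]; simp [hvaχ p hp]
  have hvadθ : ∀ p : ℝ × ℝ, p.1 < a → dθ Ψ p.1 p.2 = 0 := by
    intro p hp
    show deriv (fun θ' => Ψ p.1 θ') p.2 = 0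
    have : (fun θ' => Ψ p.1 θ') = fun _ => 0 := funext fun θ' => hvaΨ (p.1, θ') hp
    rw [this, deriv_const]
  have hD0 : ∀ R, Ψ R 0 = 0 := fun R => by rw [hΨ]; simp [hχ0 R]
  have hD1 : ∀ R, Ψ R (π / 2) = 0 := fun R => by rw [hΨ]; simp
  -- the two plane integrands
  have cG1 : Continuous fun p : ℝ × ℝ => W p.1 * Ψ p.1 p.2 ^ 2 :=
    continuous_weight_mul₂ hWc (cΨ.pow 2) ha fun p hp => by simp [hvaΨ p hp]
  have cG2 : Continuous fun p : ℝ × ℝ => W p.1 * dθ Ψ p.1 p.2 ^ 2 :=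
    continuous_weight_mul₂ hWc (cdθ.pow 2) ha fun p hp => by simp [hvadθ p hp]
  have sG1 : HasCompactSupport fun p : ℝ × ℝ => W p.1 * Ψ p.1 p.2 ^ 2 :=
    hΨs.mono fun p hp => by contrapose! hp; simp only [mem_support, ne_eq, not_not] at hp ⊢; simp [show Ψ p.1 p.2 = 0 from hp]
  have sG2 : HasCompactSupport fun p : ℝ × ℝ => W p.1 * dθ Ψ p.1 p.2 ^ 2 :=
    hdθΨs.mono fun p hp => by contrapose! hp; simp only [mem_support, ne_eq, not_not] at hp ⊢; simp [show dθ Ψ p.1 p.2 = 0 from hp]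
  have i1 : IntegrableOn (fun p : ℝ × ℝ => W p.1 * Ψ p.1 p.2 ^ 2 * Real.sin (2 * p.2) ^ (-η)) strip :=
    integrableOn_strip_mul_rpow_of_continuous hη0 hη1 cG1 sG1
  have i2 : IntegrableOn (fun p : ℝ × ℝ => 10 * (W p.1 * dθ Ψ p.1 p.2 ^ 2)) strip :=
    ((cG2.integrable_of_hasCompactSupport sG2).const_mul _).integrableOn
  rw [← MeasureTheory.integral_const_mul]
  refine integral_strip_mono_of_slices i1 i2 fun R hR => ?_
  -- the slice inequality
  have huR : ContDiff ℝ 1 fun θ => Ψ R θ := hΨ1.comp (contDiff_const.prodMk contDiff_id)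
  have hdu : deriv (fun θ => Ψ R θ) = fun θ => dθ Ψ R θ := rfl
  have h1 := integral_Ioo_sq_mul_rpow_le_deriv hη0 hη1 huR (hD0 R) (hD1 R)
  rw [hdu] at h1
  simp only at h1 ⊢
  have cu : Continuous fun θ => Ψ R θ := cΨ.comp (Continuous.prodMk_right R)
  have cdu : Continuous fun θ => dθ Ψ R θ := cdθ.comp (Continuous.prodMk_right R)
  have j2 : IntegrableOn (fun θ => dθ Ψ R θ ^ 2) (Ioo 0 (π / 2)) :=
    ((cdu.pow 2).continuousOn.integrableOn_Icc (a := 0) (b := π / 2)).mono_set Ioo_subset_Icc_self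
  have e1 : ∫ θ in Ioo 0 (π / 2), W R * Ψ R θ ^ 2 * Real.sin (2 * θ) ^ (-η) =
      W R * ∫ θ in Ioo 0 (π / 2), Ψ R θ ^ 2 * Real.sin (2 * θ) ^ (-η) := by
    rw [← MeasureTheory.integral_const_mul]; exact integral_congr_ae (ae_of_all _ fun θ => by ring)
  have e2 : ∫ θ in Ioo 0 (π / 2), 10 * (W R * dθ Ψ R θ ^ 2) = W R * (10 * ∫ θ in Ioo 0 (π / 2), dθ Ψ R θ ^ 2) := by
    rw [← MeasureTheory.integral_const_mul, ← MeasureTheory.integral_const_mul]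
    exact integral_congr_ae (ae_of_all _ fun θ => by ring)
  rw [e1, e2]
  exact mul_le_mul_of_nonneg_left h1 (hW0 R hR)

/-- **`∫∫ R²W u (∂_RΨ)² ≤ 10∫∫ R²W (∂_{Rθ}Ψ)²`** (Lemma 7.2 on the Dirichlet slices `∂_RΨ(R,·)`).
[cite: Elgindi2021, §7.3 proof of Proposition 7.7 Step 2, estimate of `I₂` (p. 21 of arXiv:1904.04795)] -/
theorem integral_strip_dz_sq_rpow_le_ten :
    ∫ p in strip, p.1 ^ 2 * W p.1 * dz Ψ p.1 p.2 ^ 2 * Real.sin (2 * p.2) ^ (-η) ≤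
      10 * ∫ p in strip, p.1 ^ 2 * W p.1 * dz (dθ Ψ) p.1 p.2 ^ 2 := by
  have hχ1 : ContDiff ℝ 1 (uncurry χ) := hχ.of_le (by norm_num)
  have hχ2 : ContDiff ℝ 2 (uncurry χ) := hχ.of_le (by norm_num)
  have hΨ3 : ContDiff ℝ 3 (uncurry Ψ) := by rw [hΨ]; exact contDiff_cosProfile hχ
  have hΨ2 : ContDiff ℝ 2 (uncurry Ψ) := hΨ3.of_le (by norm_num)
  have hΨs : HasCompactSupport (uncurry Ψ) := by rw [hΨ]; exact hasCompactSupport_cosProfile hs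
  have hdzΨ : ContDiff ℝ 2 (uncurry (dz Ψ)) := contDiff_dz_of_contDiff (n := 2) hΨ3
  have hdθΨ : ContDiff ℝ 2 (uncurry (dθ Ψ)) := contDiff_dθ_of_contDiff (n := 2) hΨ3
  have hdzdθΨ : ContDiff ℝ 1 (uncurry (dz (dθ Ψ))) := contDiff_dz_of_contDiff (n := 1) hdθΨ
  have hdθdzΨ : ContDiff ℝ 1 (uncurry (dθ (dz Ψ))) := contDiff_dθ_of_contDiff (n := 1) hdzΨ
  have hdzΨs : HasCompactSupport (uncurry (dz Ψ)) := hasCompactSupport_dz hΨs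
  have hdzdθΨs : HasCompactSupport (uncurry (dz (dθ Ψ))) := hasCompactSupport_dz (hasCompactSupport_dθ_of hΨs)
  have hdzχ : ContDiff ℝ 2 (uncurry (dz χ)) := contDiff_dz_of_contDiff (n := 2) hχ
  have cdz : Continuous fun p : ℝ × ℝ => dz Ψ p.1 p.2 := hdzΨ.continuous
  have cdzdθ : Continuous fun p : ℝ × ℝ => dz (dθ Ψ) p.1 p.2 := hdzdθΨ.continuous
  have cdθdz : Continuous fun p : ℝ × ℝ => dθ (dz Ψ) p.1 p.2 := hdθdzΨ.continuous
  obtain ⟨a, ha, hva⟩ := exists_pos_forall_fst_lt_eq_zero hs hpos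
  have hvaχ : ∀ p : ℝ × ℝ, p.1 < a → χ p.1 p.2 = 0 := fun p hp => hva p hp
  have hvaΨ : ∀ p : ℝ × ℝ, p.1 < a → Ψ p.1 p.2 = 0 := fun p hp => by rw [hΨ]; simp [hvaχ p hp]
  have vanish_dz : ∀ (G : ℝ → ℝ → ℝ), (∀ p : ℝ × ℝ, p.1 < a → G p.1 p.2 = 0) → ∀ p : ℝ × ℝ, p.1 < a → dz G p.1 p.2 = 0 := by
    intro G hG p hp
    show deriv (fun R' => G R' p.2) p.1 = 0
    have : (fun R' => G R' p.2) =ᶠ[𝓝 p.1] fun _ => 0 :=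
      Filter.eventuallyEq_of_mem (Iio_mem_nhds hp) fun R' hR' => hG (R', p.2) hR'
    rw [this.deriv_eq, deriv_const]
  have hvadθ : ∀ p : ℝ × ℝ, p.1 < a → dθ Ψ p.1 p.2 = 0 := by
    intro p hp
    show deriv (fun θ' => Ψ p.1 θ') p.2 = 0
    have : (fun θ' => Ψ p.1 θ') = fun _ => 0 := funext fun θ' => hvaΨ (p.1, θ') hp
    rw [this, deriv_const]
  have hvadz : ∀ p : ℝ × ℝ, p.1 < a → dz Ψ p.1 p.2 = 0 := vanish_dz Ψ hvaΨ
  have hvadzdθ : ∀ p : ℝ × ℝ, p.1 < a → dz (dθ Ψ) p.1 p.2 = 0 := vanish_dz (dθ Ψ) hvadθ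
  have hdzχ0 : ∀ R, dz χ R 0 = 0 := dz_eq_zero_of_forall hχ0
  have hdzΨ_eq : ∀ R θ, dz Ψ R θ = Real.cos θ * dz χ R θ := fun R θ => by rw [hΨ, dz_cosProfile hχ1]
  have hE0 : ∀ R, dz Ψ R 0 = 0 := fun R => by rw [hdzΨ_eq]; simp [hdzχ0 R]
  have hE1 : ∀ R, dz Ψ R (π / 2) = 0 := fun R => by rw [hdzΨ_eq]; simp
  have hcomm1 : ∀ p ∈ strip, dθ (dz Ψ) p.1 p.2 = dz (dθ Ψ) p.1 p.2 := fun p hp => dθ_dz_eq_dz_dθ hΨ2.contDiffOn hp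
  have hMc : ContinuousOn (fun R => R ^ 2 * W R) (Ioi 0) := (continuousOn_id.pow 2).mul hWc
  -- the two plane integrands
  have cG1 : Continuous fun p : ℝ × ℝ => p.1 ^ 2 * W p.1 * dz Ψ p.1 p.2 ^ 2 := by
    rw [show (fun p : ℝ × ℝ => p.1 ^ 2 * W p.1 * dz Ψ p.1 p.2 ^ 2) = fun p => (p.1 ^ 2 * W p.1) * dz Ψ p.1 p.2 ^ 2 from
      funext fun p => by ring]
    exact continuous_weight_mul₂ (W := fun R => R ^ 2 * W R) hMc (cdz.pow 2) ha fun p hp => by simp [hvadz p hp]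
  have cG2 : Continuous fun p : ℝ × ℝ => p.1 ^ 2 * W p.1 * dz (dθ Ψ) p.1 p.2 ^ 2 := by
    rw [show (fun p : ℝ × ℝ => p.1 ^ 2 * W p.1 * dz (dθ Ψ) p.1 p.2 ^ 2) = fun p => (p.1 ^ 2 * W p.1) * dz (dθ Ψ) p.1 p.2 ^ 2 from
      funext fun p => by ring]
    exact continuous_weight_mul₂ (W := fun R => R ^ 2 * W R) hMc (cdzdθ.pow 2) ha fun p hp => by simp [hvadzdθ p hp]
  have sG1 : HasCompactSupport fun p : ℝ × ℝ => p.1 ^ 2 * W p.1 * dz Ψ p.1 p.2 ^ 2 :=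
    hdzΨs.mono fun p hp => by contrapose! hp; simp only [mem_support, ne_eq, not_not] at hp ⊢; simp [show dz Ψ p.1 p.2 = 0 from hp]
  have sG2 : HasCompactSupport fun p : ℝ × ℝ => p.1 ^ 2 * W p.1 * dz (dθ Ψ) p.1 p.2 ^ 2 :=
    hdzdθΨs.mono fun p hp => by contrapose! hp; simp only [mem_support, ne_eq, not_not] at hp ⊢; simp [show dz (dθ Ψ) p.1 p.2 = 0 from hp]
  have i1 : IntegrableOn (fun p : ℝ × ℝ => p.1 ^ 2 * W p.1 * dz Ψ p.1 p.2 ^ 2 * Real.sin (2 * p.2) ^ (-η)) strip :=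
    integrableOn_strip_mul_rpow_of_continuous hη0 hη1 cG1 sG1
  have i2 : IntegrableOn (fun p : ℝ × ℝ => 10 * (p.1 ^ 2 * W p.1 * dz (dθ Ψ) p.1 p.2 ^ 2)) strip :=
    ((cG2.integrable_of_hasCompactSupport sG2).const_mul _).integrableOn
  rw [← MeasureTheory.integral_const_mul]
  refine integral_strip_mono_of_slices i1 i2 fun R hR => ?_
  have hfθ : ContDiff ℝ 1 fun θ => dz Ψ R θ := (hdzΨ.of_le (by norm_num)).comp (contDiff_const.prodMk contDiff_id)
  have hdf : deriv (fun θ => dz Ψ R θ) = fun θ => dθ (dz Ψ) R θ := rfl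
  have h1 := integral_Ioo_sq_mul_rpow_le_deriv hη0 hη1 hfθ (hE0 R) (hE1 R)
  rw [hdf] at h1
  simp only at h1 ⊢
  have e0 : ∫ θ in Ioo 0 (π / 2), dθ (dz Ψ) R θ ^ 2 = ∫ θ in Ioo 0 (π / 2), dz (dθ Ψ) R θ ^ 2 :=
    setIntegral_congr_fun measurableSet_Ioo fun θ hθ => by rw [hcomm1 (R, θ) ⟨hR, hθ⟩]
  rw [e0] at h1
  have e1 : ∫ θ in Ioo 0 (π / 2), R ^ 2 * W R * dz Ψ R θ ^ 2 * Real.sin (2 * θ) ^ (-η) =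
      R ^ 2 * W R * ∫ θ in Ioo 0 (π / 2), dz Ψ R θ ^ 2 * Real.sin (2 * θ) ^ (-η) := by
    rw [← MeasureTheory.integral_const_mul]; exact integral_congr_ae (ae_of_all _ fun θ => by ring)
  have e2 : ∫ θ in Ioo 0 (π / 2), 10 * (R ^ 2 * W R * dz (dθ Ψ) R θ ^ 2) =
      R ^ 2 * W R * (10 * ∫ θ in Ioo 0 (π / 2), dz (dθ Ψ) R θ ^ 2) := by
    rw [← MeasureTheory.integral_const_mul, ← MeasureTheory.integral_const_mul]
    exact integral_congr_ae (ae_of_all _ fun θ => by ring)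
  rw [e1, e2]
  exact mul_le_mul_of_nonneg_left h1 (mul_nonneg (sq_nonneg _) (hW0 R hR))

omit hχ0 hΨ in
/-- The `sec(θ)Ψ`-term: **`∫∫ W u χ² ≤ (4/(1−η))∫∫ W χ² + (π²/(2(1−η)))∫∫ W (∂_θχ)²`** (no Dirichlet
data at `θ = π/2`; the elementary embedding slice-wise). [cite: Elgindi2021, §7.3 proof of Proposition 7.7 Step 2, the error terms `E` of `I₄` (p. 21–22 of arXiv:1904.04795)] -/
theorem integral_strip_chi_sq_rpow_le :
    ∫ p in strip, W p.1 * χ p.1 p.2 ^ 2 * Real.sin (2 * p.2) ^ (-η) ≤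
      4 / (1 - η) * (∫ p in strip, W p.1 * χ p.1 p.2 ^ 2) +
        π ^ 2 / (2 * (1 - η)) * ∫ p in strip, W p.1 * dθ χ p.1 p.2 ^ 2 := by
  have hdθχ : ContDiff ℝ 2 (uncurry (dθ χ)) := contDiff_dθ_of_contDiff (n := 2) hχ
  have hdθχs : HasCompactSupport (uncurry (dθ χ)) := hasCompactSupport_dθ_of hs
  have cχ : Continuous fun p : ℝ × ℝ => χ p.1 p.2 := hχ.continuous
  have cdθχ : Continuous fun p : ℝ × ℝ => dθ χ p.1 p.2 := hdθχ.continuous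
  obtain ⟨a, ha, hva⟩ := exists_pos_forall_fst_lt_eq_zero hs hpos
  have hvaχ : ∀ p : ℝ × ℝ, p.1 < a → χ p.1 p.2 = 0 := fun p hp => hva p hp
  have hvadθχ : ∀ p : ℝ × ℝ, p.1 < a → dθ χ p.1 p.2 = 0 := by
    intro p hp
    show deriv (fun θ' => χ p.1 θ') p.2 = 0
    have : (fun θ' => χ p.1 θ') = fun _ => 0 := funext fun θ' => hvaχ (p.1, θ') hp
    rw [this, deriv_const]
  have h1η : 0 < 1 - η := by linarith
  have cG1 : Continuous fun p : ℝ × ℝ => W p.1 * χ p.1 p.2 ^ 2 :=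
    continuous_weight_mul₂ hWc (cχ.pow 2) ha fun p hp => by simp [hvaχ p hp]
  have cG2 : Continuous fun p : ℝ × ℝ => W p.1 * dθ χ p.1 p.2 ^ 2 :=
    continuous_weight_mul₂ hWc (cdθχ.pow 2) ha fun p hp => by simp [hvadθχ p hp]
  have sG1 : HasCompactSupport fun p : ℝ × ℝ => W p.1 * χ p.1 p.2 ^ 2 :=
    hs.mono fun p hp => by contrapose! hp; simp only [mem_support, ne_eq, not_not] at hp ⊢; simp [show χ p.1 p.2 = 0 from hp]
  have sG2 : HasCompactSupport fun p : ℝ × ℝ => W p.1 * dθ χ p.1 p.2 ^ 2 :=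
    hdθχs.mono fun p hp => by contrapose! hp; simp only [mem_support, ne_eq, not_not] at hp ⊢; simp [show dθ χ p.1 p.2 = 0 from hp]
  have iG1 : Integrable fun p : ℝ × ℝ => W p.1 * χ p.1 p.2 ^ 2 := cG1.integrable_of_hasCompactSupport sG1
  have iG2 : Integrable fun p : ℝ × ℝ => W p.1 * dθ χ p.1 p.2 ^ 2 := cG2.integrable_of_hasCompactSupport sG2
  have i1 : IntegrableOn (fun p : ℝ × ℝ => W p.1 * χ p.1 p.2 ^ 2 * Real.sin (2 * p.2) ^ (-η)) strip :=
    integrableOn_strip_mul_rpow_of_continuous hη0 hη1 cG1 sG1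
  have i2 : IntegrableOn (fun p : ℝ × ℝ => 4 / (1 - η) * (W p.1 * χ p.1 p.2 ^ 2) +
      π ^ 2 / (2 * (1 - η)) * (W p.1 * dθ χ p.1 p.2 ^ 2)) strip :=
    ((iG1.const_mul _).add (iG2.const_mul _)).integrableOn
  have hsplit : ∫ p in strip, 4 / (1 - η) * (W p.1 * χ p.1 p.2 ^ 2) + π ^ 2 / (2 * (1 - η)) * (W p.1 * dθ χ p.1 p.2 ^ 2) =
      4 / (1 - η) * (∫ p in strip, W p.1 * χ p.1 p.2 ^ 2) + π ^ 2 / (2 * (1 - η)) * ∫ p in strip, W p.1 * dθ χ p.1 p.2 ^ 2 := by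
    rw [integral_add (iG1.const_mul _).integrableOn (iG2.const_mul _).integrableOn, MeasureTheory.integral_const_mul,
      MeasureTheory.integral_const_mul]
  rw [← hsplit]
  refine integral_strip_mono_of_slices i1 i2 fun R hR => ?_
  have hgR : ContDiff ℝ 1 fun θ => χ R θ := (hχ.of_le (by norm_num)).comp (contDiff_const.prodMk contDiff_id)
  have hdg : deriv (fun θ => χ R θ) = fun θ => dθ χ R θ := rfl
  have h1 := integral_Ioo_sq_mul_rpow_le_of_contDiff hη0 hη1 hgR
  rw [hdg] at h1
  simp only at h1 ⊢
  have cu : Continuous fun θ => χ R θ := cχ.comp (Continuous.prodMk_right R)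
  have cdu : Continuous fun θ => dθ χ R θ := cdθχ.comp (Continuous.prodMk_right R)
  have j1 : IntegrableOn (fun θ => 4 / (1 - η) * (W R * χ R θ ^ 2)) (Ioo 0 (π / 2)) :=
    ((((cu.pow 2).const_mul (W R)).const_mul _).continuousOn.integrableOn_Icc (a := 0) (b := π / 2)).mono_set Ioo_subset_Icc_self
  have j2 : IntegrableOn (fun θ => π ^ 2 / (2 * (1 - η)) * (W R * dθ χ R θ ^ 2)) (Ioo 0 (π / 2)) :=
    ((((cdu.pow 2).const_mul (W R)).const_mul _).continuousOn.integrableOn_Icc (a := 0) (b := π / 2)).mono_set Ioo_subset_Icc_self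
  have e1 : ∫ θ in Ioo 0 (π / 2), W R * χ R θ ^ 2 * Real.sin (2 * θ) ^ (-η) =
      W R * ∫ θ in Ioo 0 (π / 2), χ R θ ^ 2 * Real.sin (2 * θ) ^ (-η) := by
    rw [← MeasureTheory.integral_const_mul]; exact integral_congr_ae (ae_of_all _ fun θ => by ring)
  have e2 : ∫ θ in Ioo 0 (π / 2), (4 / (1 - η) * (W R * χ R θ ^ 2) + π ^ 2 / (2 * (1 - η)) * (W R * dθ χ R θ ^ 2)) =
      W R * (4 / (1 - η) * (∫ θ in Ioo 0 (π / 2), χ R θ ^ 2) + π ^ 2 / (2 * (1 - η)) * ∫ θ in Ioo 0 (π / 2), dθ χ R θ ^ 2) := by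
    rw [integral_add j1 j2, MeasureTheory.integral_const_mul, MeasureTheory.integral_const_mul, MeasureTheory.integral_const_mul,
      MeasureTheory.integral_const_mul]
    ring
  rw [e1, e2]
  refine mul_le_mul_of_nonneg_left (h1.trans (le_of_eq ?_)) (hW0 R hR)
  field_simp

omit hχ0 in
/-- The `sec(θ)Ψ`-term for `∂_θΨ`: **`∫∫ W u (∂_θΨ)² ≤ (4/(1−η))∫∫ W (∂_θΨ)² + (π²/(2(1−η)))∫∫ W (∂_θθΨ)²`**.
[cite: Elgindi2021, §7.3 proof of Proposition 7.7 Step 2, the error terms `E` of `I₄` (p. 21–22 of arXiv:1904.04795)] -/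
theorem integral_strip_dθ_sq_rpow_le :
    ∫ p in strip, W p.1 * dθ Ψ p.1 p.2 ^ 2 * Real.sin (2 * p.2) ^ (-η) ≤
      4 / (1 - η) * (∫ p in strip, W p.1 * dθ Ψ p.1 p.2 ^ 2) +
        π ^ 2 / (2 * (1 - η)) * ∫ p in strip, W p.1 * dθ (dθ Ψ) p.1 p.2 ^ 2 := by
  have hΨ3 : ContDiff ℝ 3 (uncurry Ψ) := by rw [hΨ]; exact contDiff_cosProfile hχ
  have hΨs : HasCompactSupport (uncurry Ψ) := by rw [hΨ]; exact hasCompactSupport_cosProfile hs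
  have hdθΨ : ContDiff ℝ 2 (uncurry (dθ Ψ)) := contDiff_dθ_of_contDiff (n := 2) hΨ3
  have hdθ2Ψ : ContDiff ℝ 1 (uncurry (dθ (dθ Ψ))) := contDiff_dθ_of_contDiff (n := 1) hdθΨ
  have hdθΨs : HasCompactSupport (uncurry (dθ Ψ)) := hasCompactSupport_dθ_of hΨs
  have hdθ2Ψs : HasCompactSupport (uncurry (dθ (dθ Ψ))) := hasCompactSupport_dθ_of hdθΨs
  have cdθ : Continuous fun p : ℝ × ℝ => dθ Ψ p.1 p.2 := hdθΨ.continuous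
  have cdθ2 : Continuous fun p : ℝ × ℝ => dθ (dθ Ψ) p.1 p.2 := hdθ2Ψ.continuous
  obtain ⟨a, ha, hva⟩ := exists_pos_forall_fst_lt_eq_zero hs hpos
  have hvaχ : ∀ p : ℝ × ℝ, p.1 < a → χ p.1 p.2 = 0 := fun p hp => hva p hp
  have hvaΨ : ∀ p : ℝ × ℝ, p.1 < a → Ψ p.1 p.2 = 0 := fun p hp => by rw [hΨ]; simp [hvaχ p hp]
  have vanish_dθ : ∀ (G : ℝ → ℝ → ℝ), (∀ p : ℝ × ℝ, p.1 < a → G p.1 p.2 = 0) → ∀ p : ℝ × ℝ, p.1 < a → dθ G p.1 p.2 = 0 := by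
    intro G hG p hp
    show deriv (fun θ' => G p.1 θ') p.2 = 0
    have : (fun θ' => G p.1 θ') = fun _ => 0 := funext fun θ' => hG (p.1, θ') hp
    rw [this, deriv_const]
  have hvadθ : ∀ p : ℝ × ℝ, p.1 < a → dθ Ψ p.1 p.2 = 0 := vanish_dθ Ψ hvaΨ
  have hvadθ2 : ∀ p : ℝ × ℝ, p.1 < a → dθ (dθ Ψ) p.1 p.2 = 0 := vanish_dθ (dθ Ψ) hvadθ
  have h1η : 0 < 1 - η := by linarith
  have cG1 : Continuous fun p : ℝ × ℝ => W p.1 * dθ Ψ p.1 p.2 ^ 2 :=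
    continuous_weight_mul₂ hWc (cdθ.pow 2) ha fun p hp => by simp [hvadθ p hp]
  have cG2 : Continuous fun p : ℝ × ℝ => W p.1 * dθ (dθ Ψ) p.1 p.2 ^ 2 :=
    continuous_weight_mul₂ hWc (cdθ2.pow 2) ha fun p hp => by simp [hvadθ2 p hp]
  have sG1 : HasCompactSupport fun p : ℝ × ℝ => W p.1 * dθ Ψ p.1 p.2 ^ 2 :=
    hdθΨs.mono fun p hp => by contrapose! hp; simp only [mem_support, ne_eq, not_not] at hp ⊢; simp [show dθ Ψ p.1 p.2 = 0 from hp]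
  have sG2 : HasCompactSupport fun p : ℝ × ℝ => W p.1 * dθ (dθ Ψ) p.1 p.2 ^ 2 :=
    hdθ2Ψs.mono fun p hp => by contrapose! hp; simp only [mem_support, ne_eq, not_not] at hp ⊢; simp [show dθ (dθ Ψ) p.1 p.2 = 0 from hp]
  have iG1 : Integrable fun p : ℝ × ℝ => W p.1 * dθ Ψ p.1 p.2 ^ 2 := cG1.integrable_of_hasCompactSupport sG1
  have iG2 : Integrable fun p : ℝ × ℝ => W p.1 * dθ (dθ Ψ) p.1 p.2 ^ 2 := cG2.integrable_of_hasCompactSupport sG2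
  have i1 : IntegrableOn (fun p : ℝ × ℝ => W p.1 * dθ Ψ p.1 p.2 ^ 2 * Real.sin (2 * p.2) ^ (-η)) strip :=
    integrableOn_strip_mul_rpow_of_continuous hη0 hη1 cG1 sG1
  have i2 : IntegrableOn (fun p : ℝ × ℝ => 4 / (1 - η) * (W p.1 * dθ Ψ p.1 p.2 ^ 2) +
      π ^ 2 / (2 * (1 - η)) * (W p.1 * dθ (dθ Ψ) p.1 p.2 ^ 2)) strip :=
    ((iG1.const_mul _).add (iG2.const_mul _)).integrableOn
  have hsplit : ∫ p in strip, 4 / (1 - η) * (W p.1 * dθ Ψ p.1 p.2 ^ 2) + π ^ 2 / (2 * (1 - η)) * (W p.1 * dθ (dθ Ψ) p.1 p.2 ^ 2) =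
      4 / (1 - η) * (∫ p in strip, W p.1 * dθ Ψ p.1 p.2 ^ 2) + π ^ 2 / (2 * (1 - η)) * ∫ p in strip, W p.1 * dθ (dθ Ψ) p.1 p.2 ^ 2 := by
    rw [integral_add (iG1.const_mul _).integrableOn (iG2.const_mul _).integrableOn, MeasureTheory.integral_const_mul,
      MeasureTheory.integral_const_mul]
  rw [← hsplit]
  refine integral_strip_mono_of_slices i1 i2 fun R hR => ?_
  have hgR : ContDiff ℝ 1 fun θ => dθ Ψ R θ := (hdθΨ.of_le (by norm_num)).comp (contDiff_const.prodMk contDiff_id)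
  have hdg : deriv (fun θ => dθ Ψ R θ) = fun θ => dθ (dθ Ψ) R θ := rfl
  have h1 := integral_Ioo_sq_mul_rpow_le_of_contDiff hη0 hη1 hgR
  rw [hdg] at h1
  simp only at h1 ⊢
  have cu : Continuous fun θ => dθ Ψ R θ := cdθ.comp (Continuous.prodMk_right R)
  have cdu : Continuous fun θ => dθ (dθ Ψ) R θ := cdθ2.comp (Continuous.prodMk_right R)
  have j1 : IntegrableOn (fun θ => 4 / (1 - η) * (W R * dθ Ψ R θ ^ 2)) (Ioo 0 (π / 2)) :=
    ((((cu.pow 2).const_mul (W R)).const_mul _).continuousOn.integrableOn_Icc (a := 0) (b := π / 2)).mono_set Ioo_subset_Icc_self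
  have j2 : IntegrableOn (fun θ => π ^ 2 / (2 * (1 - η)) * (W R * dθ (dθ Ψ) R θ ^ 2)) (Ioo 0 (π / 2)) :=
    ((((cdu.pow 2).const_mul (W R)).const_mul _).continuousOn.integrableOn_Icc (a := 0) (b := π / 2)).mono_set Ioo_subset_Icc_self
  have e1 : ∫ θ in Ioo 0 (π / 2), W R * dθ Ψ R θ ^ 2 * Real.sin (2 * θ) ^ (-η) =
      W R * ∫ θ in Ioo 0 (π / 2), dθ Ψ R θ ^ 2 * Real.sin (2 * θ) ^ (-η) := by
    rw [← MeasureTheory.integral_const_mul]; exact integral_congr_ae (ae_of_all _ fun θ => by ring)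
  have e2 : ∫ θ in Ioo 0 (π / 2), (4 / (1 - η) * (W R * dθ Ψ R θ ^ 2) + π ^ 2 / (2 * (1 - η)) * (W R * dθ (dθ Ψ) R θ ^ 2)) =
      W R * (4 / (1 - η) * (∫ θ in Ioo 0 (π / 2), dθ Ψ R θ ^ 2) + π ^ 2 / (2 * (1 - η)) * ∫ θ in Ioo 0 (π / 2), dθ (dθ Ψ) R θ ^ 2) := by
    rw [integral_add j1 j2, MeasureTheory.integral_const_mul, MeasureTheory.integral_const_mul, MeasureTheory.integral_const_mul,
      MeasureTheory.integral_const_mul]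
    ring
  rw [e1, e2]
  refine mul_le_mul_of_nonneg_left (h1.trans (le_of_eq ?_)) (hW0 R hR)
  field_simp

/-- The sharp term in `∂_RΨ`: **`(1+η)²∫∫ R²W c² u (∂_RΨ/s)² ≤ ∫∫ R²W u (∂_{Rθ}Ψ)²`** (`c = cos 2θ`,
`s = sin 2θ`; Corollary 7.6 on the Dirichlet slices `∂_RΨ(R,·)`, and `c² ≤ 1`).
[cite: Elgindi2021, §7.3 proof of Proposition 7.7 Step 2, "by the sharp Hardy inequality (7.6)" (p. 21 of arXiv:1904.04795)] -/
theorem integral_strip_sharpHardy_dz :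
    (1 + η) ^ 2 * (∫ p in strip, p.1 ^ 2 * W p.1 * Real.cos (2 * p.2) ^ 2 * (dz Ψ p.1 p.2 / Real.sin (2 * p.2)) ^ 2 *
        Real.sin (2 * p.2) ^ (-η)) ≤
      ∫ p in strip, p.1 ^ 2 * W p.1 * dz (dθ Ψ) p.1 p.2 ^ 2 * Real.sin (2 * p.2) ^ (-η) := by
  have hχ1 : ContDiff ℝ 1 (uncurry χ) := hχ.of_le (by norm_num)
  have hΨ3 : ContDiff ℝ 3 (uncurry Ψ) := by rw [hΨ]; exact contDiff_cosProfile hχ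
  have hΨ2 : ContDiff ℝ 2 (uncurry Ψ) := hΨ3.of_le (by norm_num)
  have hΨs : HasCompactSupport (uncurry Ψ) := by rw [hΨ]; exact hasCompactSupport_cosProfile hs
  have hdzΨ : ContDiff ℝ 2 (uncurry (dz Ψ)) := contDiff_dz_of_contDiff (n := 2) hΨ3
  have hdθΨ : ContDiff ℝ 2 (uncurry (dθ Ψ)) := contDiff_dθ_of_contDiff (n := 2) hΨ3
  have hdzdθΨ : ContDiff ℝ 1 (uncurry (dz (dθ Ψ))) := contDiff_dz_of_contDiff (n := 1) hdθΨ
  have hdzΨs : HasCompactSupport (uncurry (dz Ψ)) := hasCompactSupport_dz hΨs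
  have hdzdθΨs : HasCompactSupport (uncurry (dz (dθ Ψ))) := hasCompactSupport_dz (hasCompactSupport_dθ_of hΨs)
  have hdzχ : ContDiff ℝ 2 (uncurry (dz χ)) := contDiff_dz_of_contDiff (n := 2) hχ
  have hdzχs : HasCompactSupport (uncurry (dz χ)) := hasCompactSupport_dz hs
  have cdz : Continuous fun p : ℝ × ℝ => dz Ψ p.1 p.2 := hdzΨ.continuous
  have cdzdθ : Continuous fun p : ℝ × ℝ => dz (dθ Ψ) p.1 p.2 := hdzdθΨ.continuous
  obtain ⟨a, ha, hva⟩ := exists_pos_forall_fst_lt_eq_zero hs hpos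
  have hvaχ : ∀ p : ℝ × ℝ, p.1 < a → χ p.1 p.2 = 0 := fun p hp => hva p hp
  have hvaΨ : ∀ p : ℝ × ℝ, p.1 < a → Ψ p.1 p.2 = 0 := fun p hp => by rw [hΨ]; simp [hvaχ p hp]
  have vanish_dz : ∀ (G : ℝ → ℝ → ℝ), (∀ p : ℝ × ℝ, p.1 < a → G p.1 p.2 = 0) → ∀ p : ℝ × ℝ, p.1 < a → dz G p.1 p.2 = 0 := by
    intro G hG p hp
    show deriv (fun R' => G R' p.2) p.1 = 0
    have : (fun R' => G R' p.2) =ᶠ[𝓝 p.1] fun _ => 0 :=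
      Filter.eventuallyEq_of_mem (Iio_mem_nhds hp) fun R' hR' => hG (R', p.2) hR'
    rw [this.deriv_eq, deriv_const]
  have hvadθ : ∀ p : ℝ × ℝ, p.1 < a → dθ Ψ p.1 p.2 = 0 := by
    intro p hp
    show deriv (fun θ' => Ψ p.1 θ') p.2 = 0
    have : (fun θ' => Ψ p.1 θ') = fun _ => 0 := funext fun θ' => hvaΨ (p.1, θ') hp
    rw [this, deriv_const]
  have hvadz : ∀ p : ℝ × ℝ, p.1 < a → dz Ψ p.1 p.2 = 0 := vanish_dz Ψ hvaΨ
  have hvadzdθ : ∀ p : ℝ × ℝ, p.1 < a → dz (dθ Ψ) p.1 p.2 = 0 := vanish_dz (dθ Ψ) hvadθ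
  have hdzχ0 : ∀ R, dz χ R 0 = 0 := dz_eq_zero_of_forall hχ0
  have hdzΨ_eq : ∀ R θ, dz Ψ R θ = Real.cos θ * dz χ R θ := fun R θ => by rw [hΨ, dz_cosProfile hχ1]
  have hE0 : ∀ R, dz Ψ R 0 = 0 := fun R => by rw [hdzΨ_eq]; simp [hdzχ0 R]
  have hE1 : ∀ R, dz Ψ R (π / 2) = 0 := fun R => by rw [hdzΨ_eq]; simp
  have hcomm1 : ∀ p ∈ strip, dθ (dz Ψ) p.1 p.2 = dz (dθ Ψ) p.1 p.2 := fun p hp => dθ_dz_eq_dz_dθ hΨ2.contDiffOn hp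
  have hsin : ∀ p ∈ strip, 0 < Real.sin (2 * p.2) := fun p hp =>
    Real.sin_pos_of_pos_of_lt_pi (by linarith [hp.2.1]) (by linarith [hp.2.2])
  have hMc : ContinuousOn (fun R => R ^ 2 * W R) (Ioi 0) := (continuousOn_id.pow 2).mul hWc
  -- uniform bound of the quotient and a bound for `R²W` on the radial range of the support
  obtain ⟨K₂, hK₂0, hK₂⟩ := exists_forall_abs_cos_mul_le_sin_two_mul (hdzχ.of_le (by norm_num)) hdzχs hdzχ0
  have hdzK : ∀ R, ∀ θ ∈ Icc 0 (π / 2), |dz Ψ R θ| ≤ K₂ * Real.sin (2 * θ) := fun R θ hθ => by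
    rw [hdzΨ_eq]; exact hK₂ R θ hθ
  obtain ⟨B, hB⟩ := exists_forall_fst_gt_eq_zero hΨs
  have hBdz : ∀ p : ℝ × ℝ, B < p.1 → dz Ψ p.1 p.2 = 0 := by
    intro p hp
    show deriv (fun R' => Ψ R' p.2) p.1 = 0
    have : (fun R' => Ψ R' p.2) =ᶠ[𝓝 p.1] fun _ => 0 :=
      Filter.eventuallyEq_of_mem (Ioi_mem_nhds hp) fun R' hR' => hB (R', p.2) hR'
    rw [this.deriv_eq, deriv_const]
  obtain ⟨CM, hCM⟩ := isCompact_Icc.exists_bound_of_continuousOn (s := Icc a (max a B))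
    (hMc.mono fun R hR => lt_of_lt_of_le ha hR.1)
  have hCM0 : 0 ≤ CM := (norm_nonneg _).trans (hCM a ⟨le_rfl, le_max_left _ _⟩)
  -- the quotient integrand
  have cH : ContinuousOn (fun p : ℝ × ℝ => p.1 ^ 2 * W p.1 * Real.cos (2 * p.2) ^ 2 * (dz Ψ p.1 p.2 / Real.sin (2 * p.2)) ^ 2) strip := by
    refine ContinuousOn.mul (ContinuousOn.mul ?_ (by fun_prop)) ?_
    · exact hMc.comp continuous_fst.continuousOn fun p hp => hp.1
    · exact ContinuousOn.pow (ContinuousOn.div cdz.continuousOn (by fun_prop) fun p hp => (hsin p hp).ne') 2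
  have i1' : IntegrableOn (fun p : ℝ × ℝ => p.1 ^ 2 * W p.1 * Real.cos (2 * p.2) ^ 2 * (dz Ψ p.1 p.2 / Real.sin (2 * p.2)) ^ 2 *
      Real.sin (2 * p.2) ^ (-η)) strip := by
    refine integrableOn_strip_mul_rpow hη0 hη1 (cH.aestronglyMeasurable measurableSet_strip) (C := CM * K₂ ^ 2) (B := max a B)
      (fun p hp => ?_) (fun p hp hgt => ?_)
    · by_cases hz : dz Ψ p.1 p.2 = 0
      · rw [hz]; simp; positivity
      · have hR : p.1 ∈ Icc a (max a B) := by
          constructor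
          · by_contra hlt; exact hz (hvadz p (not_le.1 hlt))
          · by_contra hlt; exact hz (hBdz p (lt_of_le_of_lt (le_max_right _ _) (not_le.1 hlt)))
        have h1 : |p.1 ^ 2 * W p.1| ≤ CM := by have := hCM p.1 hR; rwa [Real.norm_eq_abs] at this
        have h2 : |Real.cos (2 * p.2) ^ 2| ≤ 1 := by
          rw [abs_of_nonneg (sq_nonneg _), ← sq_abs]; nlinarith [abs_nonneg (Real.cos (2 * p.2)), Real.abs_cos_le_one (2 * p.2)]
        have hq : |dz Ψ p.1 p.2 / Real.sin (2 * p.2)| ≤ K₂ := by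
          rw [abs_div, abs_of_pos (hsin p hp), div_le_iff₀ (hsin p hp)]; exact hdzK p.1 p.2 (Ioo_subset_Icc_self hp.2)
        have h3 : |(dz Ψ p.1 p.2 / Real.sin (2 * p.2)) ^ 2| ≤ K₂ ^ 2 := by
          rw [abs_of_nonneg (sq_nonneg _), ← sq_abs]; exact pow_le_pow_left₀ (abs_nonneg _) hq 2
        calc _ ≤ CM * 1 * K₂ ^ 2 := abs_mul₃_le h1 h2 h3 hCM0 zero_le_one
          _ = _ := by ring
    · rw [hBdz p (lt_of_le_of_lt (le_max_right _ _) hgt)]; simp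
  have i1 : IntegrableOn (fun p : ℝ × ℝ => (1 + η) ^ 2 * (p.1 ^ 2 * W p.1 * Real.cos (2 * p.2) ^ 2 *
      (dz Ψ p.1 p.2 / Real.sin (2 * p.2)) ^ 2 * Real.sin (2 * p.2) ^ (-η))) strip := i1'.const_mul _
  have cG2 : Continuous fun p : ℝ × ℝ => p.1 ^ 2 * W p.1 * dz (dθ Ψ) p.1 p.2 ^ 2 := by
    rw [show (fun p : ℝ × ℝ => p.1 ^ 2 * W p.1 * dz (dθ Ψ) p.1 p.2 ^ 2) = fun p => (p.1 ^ 2 * W p.1) * dz (dθ Ψ) p.1 p.2 ^ 2 from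
      funext fun p => by ring]
    exact continuous_weight_mul₂ (W := fun R => R ^ 2 * W R) hMc (cdzdθ.pow 2) ha fun p hp => by simp [hvadzdθ p hp]
  have sG2 : HasCompactSupport fun p : ℝ × ℝ => p.1 ^ 2 * W p.1 * dz (dθ Ψ) p.1 p.2 ^ 2 :=
    hdzdθΨs.mono fun p hp => by contrapose! hp; simp only [mem_support, ne_eq, not_not] at hp ⊢; simp [show dz (dθ Ψ) p.1 p.2 = 0 from hp]
  have i2 : IntegrableOn (fun p : ℝ × ℝ => p.1 ^ 2 * W p.1 * dz (dθ Ψ) p.1 p.2 ^ 2 * Real.sin (2 * p.2) ^ (-η)) strip :=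
    integrableOn_strip_mul_rpow_of_continuous hη0 hη1 cG2 sG2
  rw [← MeasureTheory.integral_const_mul]
  refine integral_strip_mono_of_slices i1 i2 fun R hR => ?_
  -- the slice: sharp Hardy on `f = ∂_RΨ(R,·)`
  have hfθ : ContDiff ℝ 1 fun θ => dz Ψ R θ := (hdzΨ.of_le (by norm_num)).comp (contDiff_const.prodMk contDiff_id)
  have hdf : deriv (fun θ => dz Ψ R θ) = fun θ => dθ (dz Ψ) R θ := rfl
  have hSH := sharpHardy_sin_two_mul hη0 hη1 hfθ (hE0 R) (hE1 R)
  rw [hdf] at hSH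
  simp only at hSH ⊢
  have hPnn : 0 ≤ ∫ θ in Ioo 0 (π / 2), dz Ψ R θ ^ 2 * Real.sin (2 * θ) ^ (-η) :=
    setIntegral_nonneg measurableSet_Ioo fun θ hθ => mul_nonneg (sq_nonneg _)
      (Real.rpow_nonneg (hsin (R, θ) ⟨hR, hθ⟩).le _)
  have e0 : ∫ θ in Ioo 0 (π / 2), dθ (dz Ψ) R θ ^ 2 * Real.sin (2 * θ) ^ (-η) =
      ∫ θ in Ioo 0 (π / 2), dz (dθ Ψ) R θ ^ 2 * Real.sin (2 * θ) ^ (-η) :=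
    setIntegral_congr_fun measurableSet_Ioo fun θ hθ => by rw [hcomm1 (R, θ) ⟨hR, hθ⟩]
  rw [e0] at hSH
  -- `c² ≤ 1`
  obtain ⟨Kf, hKf0, hKf⟩ := exists_abs_le_mul_sin_two_mul hfθ (hE0 R) (hE1 R)
  have iQ := integrableOn_div_sin_sq_mul_rpow hη0 hη1 hfθ (hE0 R) (hE1 R)
  have iQc : IntegrableOn (fun θ => Real.cos (2 * θ) ^ 2 * (dz Ψ R θ / Real.sin (2 * θ)) ^ 2 * Real.sin (2 * θ) ^ (-η)) (Ioo 0 (π / 2)) := by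
    refine Integrable.mono' iQ ?_ ?_
    · have : Measurable fun θ => dz Ψ R θ := (cdz.comp (Continuous.prodMk_right R)).measurable
      have hum : Measurable fun θ : ℝ => Real.sin (2 * θ) ^ (-η) := (by fun_prop : Measurable fun θ : ℝ => Real.sin (2 * θ)).pow_const _
      exact (by fun_prop : Measurable fun θ => Real.cos (2 * θ) ^ 2 * (dz Ψ R θ / Real.sin (2 * θ)) ^ 2 *
        Real.sin (2 * θ) ^ (-η)).aestronglyMeasurable
    · rw [ae_restrict_iff' measurableSet_Ioo]
      refine Filter.Eventually.of_forall fun θ hθ => ?_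
      have hu : 0 ≤ Real.sin (2 * θ) ^ (-η) := Real.rpow_nonneg (hsin (R, θ) ⟨hR, hθ⟩).le _
      have hc2 : Real.cos (2 * θ) ^ 2 ≤ 1 := by
        rw [← sq_abs]; nlinarith [abs_nonneg (Real.cos (2 * θ)), Real.abs_cos_le_one (2 * θ)]
      rw [Real.norm_eq_abs, abs_of_nonneg (by positivity)]
      have : Real.cos (2 * θ) ^ 2 * ((dz Ψ R θ / Real.sin (2 * θ)) ^ 2 * Real.sin (2 * θ) ^ (-η)) ≤
          1 * ((dz Ψ R θ / Real.sin (2 * θ)) ^ 2 * Real.sin (2 * θ) ^ (-η)) :=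
        mul_le_mul_of_nonneg_right hc2 (by positivity)
      linarith [this]
  have hc : ∫ θ in Ioo 0 (π / 2), Real.cos (2 * θ) ^ 2 * (dz Ψ R θ / Real.sin (2 * θ)) ^ 2 * Real.sin (2 * θ) ^ (-η) ≤
      ∫ θ in Ioo 0 (π / 2), (dz Ψ R θ / Real.sin (2 * θ)) ^ 2 * Real.sin (2 * θ) ^ (-η) := by
    refine setIntegral_mono_on iQc iQ measurableSet_Ioo fun θ hθ => ?_
    have hu : 0 ≤ Real.sin (2 * θ) ^ (-η) := Real.rpow_nonneg (hsin (R, θ) ⟨hR, hθ⟩).le _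
    have hc2 : Real.cos (2 * θ) ^ 2 ≤ 1 := by
      rw [← sq_abs]; nlinarith [abs_nonneg (Real.cos (2 * θ)), Real.abs_cos_le_one (2 * θ)]
    have : Real.cos (2 * θ) ^ 2 * ((dz Ψ R θ / Real.sin (2 * θ)) ^ 2 * Real.sin (2 * θ) ^ (-η)) ≤
        1 * ((dz Ψ R θ / Real.sin (2 * θ)) ^ 2 * Real.sin (2 * θ) ^ (-η)) :=
      mul_le_mul_of_nonneg_right hc2 (by positivity)
    linarith [this]
  have e1 : ∫ θ in Ioo 0 (π / 2), (1 + η) ^ 2 * (R ^ 2 * W R * Real.cos (2 * θ) ^ 2 * (dz Ψ R θ / Real.sin (2 * θ)) ^ 2 *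
      Real.sin (2 * θ) ^ (-η)) = R ^ 2 * W R * ((1 + η) ^ 2 * ∫ θ in Ioo 0 (π / 2), Real.cos (2 * θ) ^ 2 *
        (dz Ψ R θ / Real.sin (2 * θ)) ^ 2 * Real.sin (2 * θ) ^ (-η)) := by
    rw [← MeasureTheory.integral_const_mul, ← MeasureTheory.integral_const_mul]
    exact integral_congr_ae (ae_of_all _ fun θ => by ring)
  have e2 : ∫ θ in Ioo 0 (π / 2), R ^ 2 * W R * dz (dθ Ψ) R θ ^ 2 * Real.sin (2 * θ) ^ (-η) =
      R ^ 2 * W R * ∫ θ in Ioo 0 (π / 2), dz (dθ Ψ) R θ ^ 2 * Real.sin (2 * θ) ^ (-η) := by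
    rw [← MeasureTheory.integral_const_mul]; exact integral_congr_ae (ae_of_all _ fun θ => by ring)
  rw [e1, e2]
  refine mul_le_mul_of_nonneg_left ?_ (mul_nonneg (sq_nonneg _) (hW0 R hR))
  have h1η : (0 : ℝ) ≤ 1 - η ^ 2 := by nlinarith
  nlinarith [mul_le_mul_of_nonneg_left hc (sq_nonneg (1 + η)), mul_nonneg h1η hPnn]

/-- The sharp term in `Ψ`: **`(1+η)²∫∫ W c² u (Ψ/s)² ≤ ∫∫ W u (∂_θΨ)²`** (Corollary 7.6 on the
Dirichlet slices `Ψ(R,·)`). [cite: Elgindi2021, §7.3 proof of Proposition 7.7 Step 2, the error terms `E` of `I₄` and Corollary 7.6 (p. 21–22 of arXiv:1904.04795)] -/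
theorem integral_strip_sharpHardy :
    (1 + η) ^ 2 * (∫ p in strip, W p.1 * Real.cos (2 * p.2) ^ 2 * (Ψ p.1 p.2 / Real.sin (2 * p.2)) ^ 2 *
        Real.sin (2 * p.2) ^ (-η)) ≤
      ∫ p in strip, W p.1 * dθ Ψ p.1 p.2 ^ 2 * Real.sin (2 * p.2) ^ (-η) := by
  have hχ1 : ContDiff ℝ 1 (uncurry χ) := hχ.of_le (by norm_num)
  have hΨ3 : ContDiff ℝ 3 (uncurry Ψ) := by rw [hΨ]; exact contDiff_cosProfile hχ
  have hΨ1 : ContDiff ℝ 1 (uncurry Ψ) := hΨ3.of_le (by norm_num)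
  have hΨs : HasCompactSupport (uncurry Ψ) := by rw [hΨ]; exact hasCompactSupport_cosProfile hs
  have hdθΨ : ContDiff ℝ 2 (uncurry (dθ Ψ)) := contDiff_dθ_of_contDiff (n := 2) hΨ3
  have hdθΨs : HasCompactSupport (uncurry (dθ Ψ)) := hasCompactSupport_dθ_of hΨs
  have cΨ : Continuous fun p : ℝ × ℝ => Ψ p.1 p.2 := hΨ3.continuous
  have cdθ : Continuous fun p : ℝ × ℝ => dθ Ψ p.1 p.2 := hdθΨ.continuous
  obtain ⟨a, ha, hva⟩ := exists_pos_forall_fst_lt_eq_zero hs hpos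
  have hvaχ : ∀ p : ℝ × ℝ, p.1 < a → χ p.1 p.2 = 0 := fun p hp => hva p hp
  have hvaΨ : ∀ p : ℝ × ℝ, p.1 < a → Ψ p.1 p.2 = 0 := fun p hp => by rw [hΨ]; simp [hvaχ p hp]
  have hvadθ : ∀ p : ℝ × ℝ, p.1 < a → dθ Ψ p.1 p.2 = 0 := by
    intro p hp
    show deriv (fun θ' => Ψ p.1 θ') p.2 = 0
    have : (fun θ' => Ψ p.1 θ') = fun _ => 0 := funext fun θ' => hvaΨ (p.1, θ') hp
    rw [this, deriv_const]
  have hD0 : ∀ R, Ψ R 0 = 0 := fun R => by rw [hΨ]; simp [hχ0 R]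
  have hD1 : ∀ R, Ψ R (π / 2) = 0 := fun R => by rw [hΨ]; simp
  have hsin : ∀ p ∈ strip, 0 < Real.sin (2 * p.2) := fun p hp =>
    Real.sin_pos_of_pos_of_lt_pi (by linarith [hp.2.1]) (by linarith [hp.2.2])
  obtain ⟨K₁, hK₁0, hK₁⟩ := exists_forall_abs_cos_mul_le_sin_two_mul hχ1 hs hχ0
  have hΨK : ∀ R, ∀ θ ∈ Icc 0 (π / 2), |Ψ R θ| ≤ K₁ * Real.sin (2 * θ) := fun R θ hθ => by
    rw [hΨ]; exact hK₁ R θ hθ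
  obtain ⟨B, hB⟩ := exists_forall_fst_gt_eq_zero hΨs
  obtain ⟨CW, hCW⟩ := isCompact_Icc.exists_bound_of_continuousOn (s := Icc a (max a B))
    (hWc.mono fun R hR => lt_of_lt_of_le ha hR.1)
  have hCW0 : 0 ≤ CW := (norm_nonneg _).trans (hCW a ⟨le_rfl, le_max_left _ _⟩)
  have cH : ContinuousOn (fun p : ℝ × ℝ => W p.1 * Real.cos (2 * p.2) ^ 2 * (Ψ p.1 p.2 / Real.sin (2 * p.2)) ^ 2) strip := by
    refine ContinuousOn.mul (ContinuousOn.mul ?_ (by fun_prop)) ?_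
    · exact hWc.comp continuous_fst.continuousOn fun p hp => hp.1
    · exact ContinuousOn.pow (ContinuousOn.div cΨ.continuousOn (by fun_prop) fun p hp => (hsin p hp).ne') 2
  have i1' : IntegrableOn (fun p : ℝ × ℝ => W p.1 * Real.cos (2 * p.2) ^ 2 * (Ψ p.1 p.2 / Real.sin (2 * p.2)) ^ 2 *
      Real.sin (2 * p.2) ^ (-η)) strip := by
    refine integrableOn_strip_mul_rpow hη0 hη1 (cH.aestronglyMeasurable measurableSet_strip) (C := CW * K₁ ^ 2) (B := max a B)
      (fun p hp => ?_) (fun p hp hgt => ?_)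
    · by_cases hz : Ψ p.1 p.2 = 0
      · rw [hz]; simp; positivity
      · have hR : p.1 ∈ Icc a (max a B) := by
          constructor
          · by_contra hlt; exact hz (hvaΨ p (not_le.1 hlt))
          · by_contra hlt; exact hz (hB p (lt_of_le_of_lt (le_max_right _ _) (not_le.1 hlt)))
        have h1 : |W p.1| ≤ CW := by have := hCW p.1 hR; rwa [Real.norm_eq_abs] at this
        have h2 : |Real.cos (2 * p.2) ^ 2| ≤ 1 := by
          rw [abs_of_nonneg (sq_nonneg _), ← sq_abs]; nlinarith [abs_nonneg (Real.cos (2 * p.2)), Real.abs_cos_le_one (2 * p.2)]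
        have hq : |Ψ p.1 p.2 / Real.sin (2 * p.2)| ≤ K₁ := by
          rw [abs_div, abs_of_pos (hsin p hp), div_le_iff₀ (hsin p hp)]; exact hΨK p.1 p.2 (Ioo_subset_Icc_self hp.2)
        have h3 : |(Ψ p.1 p.2 / Real.sin (2 * p.2)) ^ 2| ≤ K₁ ^ 2 := by
          rw [abs_of_nonneg (sq_nonneg _), ← sq_abs]; exact pow_le_pow_left₀ (abs_nonneg _) hq 2
        calc _ ≤ CW * 1 * K₁ ^ 2 := abs_mul₃_le h1 h2 h3 hCW0 zero_le_one
          _ = _ := by ring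
    · have hz : Ψ p.1 p.2 = 0 := hB p (lt_of_le_of_lt (le_max_right _ _) hgt)
      rw [hz]; simp
  have i1 : IntegrableOn (fun p : ℝ × ℝ => (1 + η) ^ 2 * (W p.1 * Real.cos (2 * p.2) ^ 2 *
      (Ψ p.1 p.2 / Real.sin (2 * p.2)) ^ 2 * Real.sin (2 * p.2) ^ (-η))) strip := i1'.const_mul _
  have cG2 : Continuous fun p : ℝ × ℝ => W p.1 * dθ Ψ p.1 p.2 ^ 2 :=
    continuous_weight_mul₂ hWc (cdθ.pow 2) ha fun p hp => by simp [hvadθ p hp]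
  have sG2 : HasCompactSupport fun p : ℝ × ℝ => W p.1 * dθ Ψ p.1 p.2 ^ 2 :=
    hdθΨs.mono fun p hp => by contrapose! hp; simp only [mem_support, ne_eq, not_not] at hp ⊢; simp [show dθ Ψ p.1 p.2 = 0 from hp]
  have i2 : IntegrableOn (fun p : ℝ × ℝ => W p.1 * dθ Ψ p.1 p.2 ^ 2 * Real.sin (2 * p.2) ^ (-η)) strip :=
    integrableOn_strip_mul_rpow_of_continuous hη0 hη1 cG2 sG2
  rw [← MeasureTheory.integral_const_mul]
  refine integral_strip_mono_of_slices i1 i2 fun R hR => ?_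
  have huR : ContDiff ℝ 1 fun θ => Ψ R θ := hΨ1.comp (contDiff_const.prodMk contDiff_id)
  have hdu : deriv (fun θ => Ψ R θ) = fun θ => dθ Ψ R θ := rfl
  have hSH := sharpHardy_sin_two_mul hη0 hη1 huR (hD0 R) (hD1 R)
  rw [hdu] at hSH
  simp only at hSH ⊢
  have hPnn : 0 ≤ ∫ θ in Ioo 0 (π / 2), Ψ R θ ^ 2 * Real.sin (2 * θ) ^ (-η) :=
    setIntegral_nonneg measurableSet_Ioo fun θ hθ => mul_nonneg (sq_nonneg _)
      (Real.rpow_nonneg (hsin (R, θ) ⟨hR, hθ⟩).le _)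
  have iQ := integrableOn_div_sin_sq_mul_rpow hη0 hη1 huR (hD0 R) (hD1 R)
  have iQc : IntegrableOn (fun θ => Real.cos (2 * θ) ^ 2 * (Ψ R θ / Real.sin (2 * θ)) ^ 2 * Real.sin (2 * θ) ^ (-η)) (Ioo 0 (π / 2)) := by
    refine Integrable.mono' iQ ?_ ?_
    · have : Measurable fun θ => Ψ R θ := (cΨ.comp (Continuous.prodMk_right R)).measurable
      have hum : Measurable fun θ : ℝ => Real.sin (2 * θ) ^ (-η) := (by fun_prop : Measurable fun θ : ℝ => Real.sin (2 * θ)).pow_const _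
      exact (by fun_prop : Measurable fun θ => Real.cos (2 * θ) ^ 2 * (Ψ R θ / Real.sin (2 * θ)) ^ 2 *
        Real.sin (2 * θ) ^ (-η)).aestronglyMeasurable
    · rw [ae_restrict_iff' measurableSet_Ioo]
      refine Filter.Eventually.of_forall fun θ hθ => ?_
      have hu : 0 ≤ Real.sin (2 * θ) ^ (-η) := Real.rpow_nonneg (hsin (R, θ) ⟨hR, hθ⟩).le _
      have hc2 : Real.cos (2 * θ) ^ 2 ≤ 1 := by
        rw [← sq_abs]; nlinarith [abs_nonneg (Real.cos (2 * θ)), Real.abs_cos_le_one (2 * θ)]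
      rw [Real.norm_eq_abs, abs_of_nonneg (by positivity)]
      have : Real.cos (2 * θ) ^ 2 * ((Ψ R θ / Real.sin (2 * θ)) ^ 2 * Real.sin (2 * θ) ^ (-η)) ≤
          1 * ((Ψ R θ / Real.sin (2 * θ)) ^ 2 * Real.sin (2 * θ) ^ (-η)) :=
        mul_le_mul_of_nonneg_right hc2 (by positivity)
      linarith [this]
  have hc : ∫ θ in Ioo 0 (π / 2), Real.cos (2 * θ) ^ 2 * (Ψ R θ / Real.sin (2 * θ)) ^ 2 * Real.sin (2 * θ) ^ (-η) ≤
      ∫ θ in Ioo 0 (π / 2), (Ψ R θ / Real.sin (2 * θ)) ^ 2 * Real.sin (2 * θ) ^ (-η) := by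
    refine setIntegral_mono_on iQc iQ measurableSet_Ioo fun θ hθ => ?_
    have hu : 0 ≤ Real.sin (2 * θ) ^ (-η) := Real.rpow_nonneg (hsin (R, θ) ⟨hR, hθ⟩).le _
    have hc2 : Real.cos (2 * θ) ^ 2 ≤ 1 := by
      rw [← sq_abs]; nlinarith [abs_nonneg (Real.cos (2 * θ)), Real.abs_cos_le_one (2 * θ)]
    have : Real.cos (2 * θ) ^ 2 * ((Ψ R θ / Real.sin (2 * θ)) ^ 2 * Real.sin (2 * θ) ^ (-η)) ≤
        1 * ((Ψ R θ / Real.sin (2 * θ)) ^ 2 * Real.sin (2 * θ) ^ (-η)) :=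
      mul_le_mul_of_nonneg_right hc2 (by positivity)
    linarith [this]
  have e1 : ∫ θ in Ioo 0 (π / 2), (1 + η) ^ 2 * (W R * Real.cos (2 * θ) ^ 2 * (Ψ R θ / Real.sin (2 * θ)) ^ 2 *
      Real.sin (2 * θ) ^ (-η)) = W R * ((1 + η) ^ 2 * ∫ θ in Ioo 0 (π / 2), Real.cos (2 * θ) ^ 2 *
        (Ψ R θ / Real.sin (2 * θ)) ^ 2 * Real.sin (2 * θ) ^ (-η)) := by
    rw [← MeasureTheory.integral_const_mul, ← MeasureTheory.integral_const_mul]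
    exact integral_congr_ae (ae_of_all _ fun θ => by ring)
  have e2 : ∫ θ in Ioo 0 (π / 2), W R * dθ Ψ R θ ^ 2 * Real.sin (2 * θ) ^ (-η) =
      W R * ∫ θ in Ioo 0 (π / 2), dθ Ψ R θ ^ 2 * Real.sin (2 * θ) ^ (-η) := by
    rw [← MeasureTheory.integral_const_mul]; exact integral_congr_ae (ae_of_all _ fun θ => by ring)
  rw [e1, e2]
  refine mul_le_mul_of_nonneg_left ?_ (hW0 R hR)
  have h1η : (0 : ℝ) ≤ 1 - η ^ 2 := by nlinarith
  nlinarith [mul_le_mul_of_nonneg_left hc (sq_nonneg (1 + η)), mul_nonneg h1η hPnn]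

omit hχ hs hpos hχ0 hΨ in
/-- `∫∫ W G² ≤ ∫∫ W u G²` for a continuous compactly supported plane function `G` vanishing for
`R < a` (`u = sin(2θ)^{−η} ≥ 1` on the strip). [folklore] -/
theorem integral_strip_le_rpow {G : ℝ × ℝ → ℝ} (hG : Continuous G) (hGs : HasCompactSupport G)
    {a : ℝ} (ha : 0 < a) (hGa : ∀ p : ℝ × ℝ, p.1 < a → G p = 0) :
    ∫ p in strip, W p.1 * G p ^ 2 ≤ ∫ p in strip, W p.1 * G p ^ 2 * Real.sin (2 * p.2) ^ (-η) := by
  have cG1 : Continuous fun p : ℝ × ℝ => W p.1 * G p ^ 2 :=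
    continuous_weight_mul₂ hWc (hG.pow 2) ha fun p hp => by simp [hGa p hp]
  have sG1 : HasCompactSupport fun p : ℝ × ℝ => W p.1 * G p ^ 2 :=
    hGs.mono fun p hp => by contrapose! hp; simp only [mem_support, ne_eq, not_not] at hp ⊢; simp [hp]
  have i1 : IntegrableOn (fun p : ℝ × ℝ => W p.1 * G p ^ 2) strip := (cG1.integrable_of_hasCompactSupport sG1).integrableOn
  have i2 : IntegrableOn (fun p : ℝ × ℝ => W p.1 * G p ^ 2 * Real.sin (2 * p.2) ^ (-η)) strip :=
    integrableOn_strip_mul_rpow_of_continuous hη0 hη1 cG1 sG1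
  refine setIntegral_mono_on i1 i2 measurableSet_strip fun p hp => ?_
  have hs' : 0 < Real.sin (2 * p.2) := Real.sin_pos_of_pos_of_lt_pi (by linarith [hp.2.1]) (by linarith [hp.2.2])
  have hu1 : 1 ≤ Real.sin (2 * p.2) ^ (-η) := Real.one_le_rpow_of_pos_of_le_one_of_nonpos hs' (Real.sin_le_one _) (by linarith)
  have hnn : 0 ≤ W p.1 * G p ^ 2 := mul_nonneg (hW0 p.1 hp.1) (sq_nonneg _)
  nlinarith

end profile

end Elgindi

end Literature.Analysis.FluidPDE
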